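import Literature.AlgebraicGeometry.Motives.StandardConjecturesDominatedVarieties
import Literature.AlgebraicGeometry.Motives.KunnethEdgeComponentsOfAlgebraicClasses
import Literature.AlgebraicGeometry.Motives.AbstractHodgeTate
import HarnessLib

/-!
# Algebraic classes and Tate's conjecture descend to dominated varieties
(Kleiman 1968 Prop. 1.2.4; Tate 1994 §1; Kahn 2020 §3.5.1)

Let `W` be a Weil cohomology theory and `f : V ⟶ U` a morphism of smooth projective varieties,
`dim V = dim U + r`, with a rational algebraic class `ζ ∈ Aʳ(V)_ℚ` such that `f₊ ζ ≠ 0` — then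
`f₊ ζ = q · 1` with `q ∈ ℚˣ` (`U` is *dominated* by `V` through `(f, ζ)`; Kleiman 1968 Prop. 1.2.4,
`ζ` a generically finite multisection; this lane's `StandardConjecturesDominatedVarieties`).
The projection formula `f₊ (f* x ∪ ζ) = q · x` (Kahn 2020 §3.5.1) and the stability of
rational algebraic classes under pull-back, cup product and push-forward (Kleiman 1968 §1.3)
show:

* **algebraicity descends**: if `f* x` is a (`K`-linear combination of) algebraic class(es) on
  `V`, then so is `x` on `U` (`mem_ratAlgebraicClasses_of_pullback_mem`,
  `mem_algebraicClasses_of_pullback_mem`);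
* every factor of a product is dominated by the product (`exists_pushforward_fst_ne_zero`,
  `exists_pushforward_snd_ne_zero`: `pr_{X*} pr_Z^* b = tr_Z(b) · 1`).

For a Galois Weil cohomology theory `E` (Tate 1994 §1; the tree's `GaloisWeilCohomology`,
`tateClasses`, `TateConjectureFor`): pull-backs are Galois equivariant (axiom `pullback_ρ`), so
`f*` maps Galois invariants of `H²ᵖ(U)(p)` to Galois invariants of `H²ᵖ(V)(p)` and Tate classes
to Tate classes (`pullback_mem_invariants`, `pullback_mem_tateClasses`). Hence
**`Tᵖ(V) ⇒ Tᵖ(U)` for every `U` dominated by `V`** (`tateConjectureFor_of_pushforward_ne_zero`,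
`tateConjectureFor_of_pullback_top_ne_zero`), in particular
**`Tᵖ(X × Z) ⇒ Tᵖ(X)` and `Tᵖ(Z)`** (`tateConjectureFor_of_tensor_left/right`).

Theorems only; no new definitions, no named facts.

## References

* [Kleiman1968AlgebraicCycles] S. Kleiman, *Algebraic cycles and the Weil conjectures*, in: Dix
  exposés sur la cohomologie des schémas (1968), §1.2 Prop. 1.2.4, §1.3.
* [Tate1994] J. Tate, *Conjectures on algebraic cycles in ℓ-adic cohomology*, in: Motives,
  Proc. Sympos. Pure Math. 55.1 (1994), §1.
* [Kahn2020] B. Kahn, *Zeta and L-functions of varieties and motives* (2020), §3.5.1.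
-/

universe u v

open CategoryTheory AlgebraicGeometry MonoidalCategory CartesianMonoidalCategory

noncomputable section

namespace Literature.AlgebraicGeometry.Motives

namespace WeilCohomology

variable {k : Type u} [Field k] {K : Type v} [Field K] [CharZero K] (W : WeilCohomology k K)

/-! ## `K`-spans of algebraic classes under maps preserving `ℚ`-algebraic classes -/

section Span

variable {X Y : SchemeOver k}

/-- A `K`-linear map sending `Aᵃ(X)_ℚ` into `Aᵇ(Y)_ℚ` sends the `K`-span `K · Aᵃ(X)` into
`K · Aᵇ(Y)` (Kleiman 1968 §1.3, algebraic correspondences preserve algebraic classes; `K`-linear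
extension). [cite: Kleiman1968AlgebraicCycles, §1.3] -/
theorem map_algebraicClasses_le_of_ratAlgebraicClasses {a b : ℕ}
    (T : W.obj X (2 * a) →ₗ[K] W.obj Y (2 * b))
    (hT : ∀ x ∈ W.ratAlgebraicClasses X a, T x ∈ W.ratAlgebraicClasses Y b) :
    (W.algebraicClasses X a).map T ≤ W.algebraicClasses Y b := by
  unfold PreWeilCohomology.algebraicClasses
  rw [Submodule.map_span, Submodule.span_le]
  rintro _ ⟨y, hy, rfl⟩
  exact W.ratAlgebraicClasses_le_algebraicClasses Y b
    (hT y (W.algebraicLattice_le_ratAlgebraicClasses X a hy))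

end Span

variable {N M n m r : ℕ} {V U X Z : SchemeOver k}

/-- **Push-forward preserves `K`-spans of algebraic classes**: `f₊ (K · Aᵃ(V)) ⊆ K · Aᵇ(U)`
(`pushforward_mem_ratAlgebraicClasses`, `K`-linearly; Kleiman 1968 §1.3). Degrees:
`2a + d' = 2N`, `2b + d' = 2M`. [cite: Kleiman1968AlgebraicCycles, §1.3] -/
theorem pushforward_mem_algebraicClasses (hV : IsSmoothProjective N V) (hU : IsSmoothProjective M U)
    (f : V ⟶ U) {a b d' : ℕ} (he : 2 * a + d' = 2 * N) (hd : 2 * b + d' = 2 * M)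
    {α : W.obj V (2 * a)} (hα : α ∈ W.algebraicClasses V a) :
    W.pushforward (N := N) hU f he hd α ∈ W.algebraicClasses U b :=
  W.map_algebraicClasses_le_of_ratAlgebraicClasses _
    (fun _ hx ↦ W.pushforward_mem_ratAlgebraicClasses hV hU f he hd hx) ⟨α, hα, rfl⟩

/-- Cup product with a rational algebraic class preserves `K`-spans of algebraic classes:
`x ∈ K · Aᵖ(V)`, `ζ ∈ Aʳ(V)_ℚ ⇒ x ∪ ζ ∈ K · A^{p+r}(V)` (axiom `cup_mem_ratAlgebraicClasses`,
`K`-linearly). [cite: Kleiman1968AlgebraicCycles, §1.2 (C)] -/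
theorem cup_mem_algebraicClasses_of_mem_ratAlgebraicClasses (hV : IsSmoothProjective N V)
    {p c : ℕ} (hprc : p + r = c) (h : 2 * p + 2 * r = 2 * c) {ζ : W.obj V (2 * r)}
    (hζ : ζ ∈ W.ratAlgebraicClasses V r) {x : W.obj V (2 * p)} (hx : x ∈ W.algebraicClasses V p) :
    W.cup h x ζ ∈ W.algebraicClasses V c :=
  W.map_algebraicClasses_le_of_ratAlgebraicClasses ((W.cup h).flip ζ)
    (fun _ hy ↦ W.cup_mem_ratAlgebraicClasses hV hprc _ _ hy hζ) ⟨x, hx, rfl⟩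

/-! ## Algebraic classes descend to dominated varieties -/

/-- **Rational algebraic classes descend**: for `U` dominated by `V` through `(f, ζ)`
(`f₊ ζ ≠ 0`, `ζ ∈ Aʳ(V)_ℚ`), if `f* x ∈ Aᵖ(V)_ℚ` then `x ∈ Aᵖ(U)_ℚ`:
`x = q⁻¹ f₊ (f* x ∪ ζ)` by the projection formula (Kahn 2020 §3.5.1), and cup product and
push-forward preserve rational algebraic classes (Kleiman 1968 §1.3).
[cite: Kleiman1968AlgebraicCycles, §1.3] [cite: Kahn2020, §3.5.1 (projection formula)] -/
theorem mem_ratAlgebraicClasses_of_pullback_mem (hV : IsSmoothProjective N V)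
    (hU : IsSmoothProjective M U) (f : V ⟶ U) {ζ : W.obj V (2 * r)}
    (hζ : ζ ∈ W.ratAlgebraicClasses V r) {he : 2 * r + 2 * M = 2 * N} {hd : 0 + 2 * M = 2 * M}
    (hne : W.pushforward (N := N) hU f he hd ζ ≠ 0) {p : ℕ} {x : W.obj U (2 * p)}
    (hx : W.pullback f (2 * p) x ∈ W.ratAlgebraicClasses V p) : x ∈ W.ratAlgebraicClasses U p := by
  obtain ⟨q, hq⟩ := W.exists_pushforward_eq_ratCast_smul_one hV hU f hζ he hd
  have hq0 : (q : K) ≠ 0 := fun h ↦ hne (by rw [hq, h, zero_smul])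
  by_cases hp : p ≤ M
  · have hs : 2 * p + 2 * r = 2 * (p + r) := by omega
    have key : W.pushforward (N := N) hU f (e := 2 * (p + r)) (d := 2 * p) (d' := 2 * M - 2 * p)
        (by omega) (by omega) (W.cup hs (W.pullback f (2 * p) x) ζ) = (q : K) • x := by
      rw [W.pushforward_pullback_cup hV hU f hs _ _ he hd (Nat.add_zero _) x ζ, hq, map_smul,
        W.cup_one hU (Nat.add_zero _)]
    have hmem : (q : K) • x ∈ W.ratAlgebraicClasses U p := by
      rw [← key]
      exact W.pushforward_mem_ratAlgebraicClasses hV hU f _ _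
        (W.cup_mem_ratAlgebraicClasses hV (rfl : p + r = p + r) _ _ hx hζ)
    have h := W.ratCast_smul_mem_ratAlgebraicClasses hmem q⁻¹
    rwa [smul_smul, Rat.cast_inv, inv_mul_cancel₀ hq0, one_smul] at h
  · haveI := W.subsingleton_obj hU (i := 2 * p) (by omega)
    rw [Subsingleton.elim x 0]
    exact zero_mem _

/-- **Algebraic classes (`K`-spans) descend**: for `U` dominated by `V` through `(f, ζ)`, if
`f* x ∈ K · Aᵖ(V)` then `x ∈ K · Aᵖ(U)` (`x = q⁻¹ f₊ (f* x ∪ ζ)`; Kleiman 1968 §1.3, Kahn 2020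
§3.5.1). [cite: Kleiman1968AlgebraicCycles, §1.3] [cite: Kahn2020, §3.5.1 (projection formula)] -/
theorem mem_algebraicClasses_of_pullback_mem (hV : IsSmoothProjective N V)
    (hU : IsSmoothProjective M U) (f : V ⟶ U) {ζ : W.obj V (2 * r)}
    (hζ : ζ ∈ W.ratAlgebraicClasses V r) {he : 2 * r + 2 * M = 2 * N} {hd : 0 + 2 * M = 2 * M}
    (hne : W.pushforward (N := N) hU f he hd ζ ≠ 0) {p : ℕ} {x : W.obj U (2 * p)}
    (hx : W.pullback f (2 * p) x ∈ W.algebraicClasses V p) : x ∈ W.algebraicClasses U p := by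
  obtain ⟨q, hq⟩ := W.exists_pushforward_eq_ratCast_smul_one hV hU f hζ he hd
  have hq0 : (q : K) ≠ 0 := fun h ↦ hne (by rw [hq, h, zero_smul])
  by_cases hp : p ≤ M
  · have hs : 2 * p + 2 * r = 2 * (p + r) := by omega
    have key : W.pushforward (N := N) hU f (e := 2 * (p + r)) (d := 2 * p) (d' := 2 * M - 2 * p)
        (by omega) (by omega) (W.cup hs (W.pullback f (2 * p) x) ζ) = (q : K) • x := by
      rw [W.pushforward_pullback_cup hV hU f hs _ _ he hd (Nat.add_zero _) x ζ, hq, map_smul,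
        W.cup_one hU (Nat.add_zero _)]
    have hmem : (q : K) • x ∈ W.algebraicClasses U p := by
      rw [← key]
      exact W.pushforward_mem_algebraicClasses hV hU f _ _
        (W.cup_mem_algebraicClasses_of_mem_ratAlgebraicClasses hV rfl hs hζ hx)
    have h := Submodule.smul_mem _ ((q : K)⁻¹) hmem
    rwa [smul_smul, inv_mul_cancel₀ hq0, one_smul] at h
  · haveI := W.subsingleton_obj hU (i := 2 * p) (by omega)
    rw [Subsingleton.elim x 0]
    exact zero_mem _

/-! ## Every factor of a product is dominated by the product -/

/-- **`X` is dominated by `X × Z`** through `(pr_X, pr_Z^* b)` for `b ∈ Aᵐ(Z)_ℚ` of degree `1`: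
`pr_{X*} pr_Z^* b = tr_Z(b) · 1 = 1 ≠ 0` (`pushforward_fst_pullback_snd`,
`exists_mem_ratAlgebraicClasses_trace_eq_one`). Degrees: `2m + 2n = 2(n + m)`, `0 + 2n = 2n`.
[cite: Kleiman1968AlgebraicCycles, §1.2 Prop. 1.2.4] -/
theorem exists_pushforward_fst_ne_zero (hX : IsSmoothProjective n X) (hZ : IsSmoothProjective m Z)
    (he : 2 * m + 2 * n = 2 * (n + m)) (hd : 0 + 2 * n = 2 * n) :
    ∃ ζ ∈ W.ratAlgebraicClasses (X ⊗ Z) m,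
      W.pushforward (N := n + m) hX (fst X Z) he hd ζ ≠ 0 := by
  obtain ⟨b, hb, htr⟩ := W.exists_mem_ratAlgebraicClasses_trace_eq_one hZ
  refine ⟨W.pullback (snd X Z) (2 * m) b, W.pullback_ratAlgebraicClasses_le
    (IsSmoothProjective.tensor_holds hX hZ) hZ (snd X Z) m ⟨b, hb, rfl⟩, ?_⟩
  rw [W.pushforward_fst_pullback_snd hX hZ b he hd, htr, one_smul]
  exact W.unit_ne_zero hX

/-- **`Z` is dominated by `X × Z`** through `(pr_Z, pr_X^* a)` for `a ∈ Aⁿ(X)_ℚ` of degree `1`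
(`pushforward_snd_pullback_fst`). Degrees: `2n + 2m = 2(n + m)`, `0 + 2m = 2m`.
[cite: Kleiman1968AlgebraicCycles, §1.2 Prop. 1.2.4] -/
theorem exists_pushforward_snd_ne_zero (hX : IsSmoothProjective n X) (hZ : IsSmoothProjective m Z)
    (he : 2 * n + 2 * m = 2 * (n + m)) (hd : 0 + 2 * m = 2 * m) :
    ∃ ζ ∈ W.ratAlgebraicClasses (X ⊗ Z) n,
      W.pushforward (N := n + m) hZ (snd X Z) he hd ζ ≠ 0 := by
  obtain ⟨a, ha, htr⟩ := W.exists_mem_ratAlgebraicClasses_trace_eq_one hX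
  refine ⟨W.pullback (fst X Z) (2 * n) a, W.pullback_ratAlgebraicClasses_le
    (IsSmoothProjective.tensor_holds hX hZ) hX (fst X Z) n ⟨a, ha, rfl⟩, ?_⟩
  rw [W.pushforward_snd_pullback_fst hX hZ a he hd, htr, one_smul]
  exact W.unit_ne_zero hZ

/-- **A class on `X` is algebraic iff its pull-back to `X × Z` is** (`K`-spans): descent along
`pr_X` (`mem_algebraicClasses_of_pullback_mem`, `exists_pushforward_fst_ne_zero`) and the axiom
`pullback_ratAlgebraicClasses_le`. [cite: Kleiman1968AlgebraicCycles, §1.3] -/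
theorem pullback_fst_mem_algebraicClasses_iff (hX : IsSmoothProjective n X)
    (hZ : IsSmoothProjective m Z) {p : ℕ} (x : W.obj X (2 * p)) :
    W.pullback (fst X Z) (2 * p) x ∈ W.algebraicClasses (X ⊗ Z) p ↔
      x ∈ W.algebraicClasses X p := by
  have hXZ := IsSmoothProjective.tensor_holds hX hZ
  obtain ⟨ζ, hζ, hne⟩ := W.exists_pushforward_fst_ne_zero hX hZ
    (by omega : 2 * m + 2 * n = 2 * (n + m)) (Nat.zero_add _)
  refine ⟨fun h ↦ W.mem_algebraicClasses_of_pullback_mem hXZ hX (fst X Z) hζ hne h, fun h ↦ ?_⟩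
  exact W.map_algebraicClasses_le_of_ratAlgebraicClasses _
    (fun y hy ↦ W.pullback_ratAlgebraicClasses_le hXZ hX (fst X Z) p ⟨y, hy, rfl⟩) ⟨x, h, rfl⟩

end WeilCohomology

/-! ## Tate's conjecture descends -/

namespace GaloisWeilCohomology

variable {k : Type u} [Field k] {K : Type v} [Field K] [CharZero K]
  {χ : Field.absoluteGaloisGroup k →* Kˣ} (E : GaloisWeilCohomology k K χ)
variable {N M n m r : ℕ} {V U X Z : SchemeOver k}

/-- **Pull-backs are equivariant for the Tate-twisted Galois actions**:
`(χ(g)ʲ g) ∘ f* = f* ∘ (χ(g)ʲ g)` on `Hⁱ` (axiom `pullback_ρ`, Tate 1994 §1). [cite: Tate1994, §1] -/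
theorem ρTwist_pullback (hV : IsSmoothProjective N V) (hU : IsSmoothProjective M U) (f : V ⟶ U)
    (i : ℕ) (j : ℤ) (g : Field.absoluteGaloisGroup k) (x : E.obj U i) :
    E.ρTwist V i j g (E.pullback f i x) = E.pullback f i (E.ρTwist U i j g x) := by
  rw [E.ρTwist_apply, E.ρTwist_apply, map_smul, ← LinearMap.comp_apply, E.pullback_ρ hV hU f i g,
    LinearMap.comp_apply]

/-- **`f*` maps Galois invariants of `Hⁱ(U)(j)` to Galois invariants of `Hⁱ(V)(j)`** (Tate 1994 §1;
functoriality of étale cohomology). [cite: Tate1994, §1] -/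
theorem pullback_mem_invariants (hV : IsSmoothProjective N V) (hU : IsSmoothProjective M U)
    (f : V ⟶ U) {i : ℕ} {j : ℤ} {x : E.obj U i} (hx : x ∈ (E.ρTwist U i j).invariants) :
    E.pullback f i x ∈ (E.ρTwist V i j).invariants := fun g ↦ by
  rw [E.ρTwist_pullback hV hU f i j g x, hx g]

/-- **`f*` maps Tate classes to Tate classes** (classes invariant under an open subgroup;
Tate 1994 §1). [cite: Tate1994, §1] -/
theorem pullback_mem_tateClasses (hV : IsSmoothProjective N V) (hU : IsSmoothProjective M U)
    (f : V ⟶ U) {p : ℕ} {x : E.obj U (2 * p)} (hx : x ∈ E.tateClasses U p) :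
    E.pullback f (2 * p) x ∈ E.tateClasses V p := by
  simp only [GaloisWeilCohomology.tateClasses, mem_smoothInvariants_iff] at hx ⊢
  obtain ⟨O, hO⟩ := hx
  exact ⟨O, fun g hg ↦ by rw [E.ρTwist_pullback hV hU f _ _ g x, hO g hg]⟩

/-- **`Tᵖ(V) ⇒ Tᵖ(U)` for `U` dominated by `V`**: `f : V ⟶ U`, `dim V = dim U + r`, `f₊ ζ ≠ 0` for
some `ζ ∈ Aʳ(V)_ℚ` (Kleiman 1968 Prop. 1.2.4). A Galois-invariant `x ∈ H²ᵖ(U)(p)` pulls back to a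
Galois-invariant class on `V` (`pullback_mem_invariants`), algebraic by `Tᵖ(V)`, so `x` is
algebraic (`mem_algebraicClasses_of_pullback_mem`); with the trivial inclusion
`algebraicClasses_le_invariants` (Tate 1994 §1). [cite: Tate1994, §1 (Conjecture Tᵖ)]
[cite: Kleiman1968AlgebraicCycles, §1.2 Prop. 1.2.4] -/
theorem tateConjectureFor_of_pushforward_ne_zero (hV : IsSmoothProjective N V)
    (hU : IsSmoothProjective M U) (f : V ⟶ U) {ζ : E.obj V (2 * r)}
    (hζ : ζ ∈ E.ratAlgebraicClasses V r) {he : 2 * r + 2 * M = 2 * N} {hd : 0 + 2 * M = 2 * M}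
    (hne : E.pushforward (N := N) hU f he hd ζ ≠ 0) {p : ℕ} (hT : E.TateConjectureFor V p) :
    E.TateConjectureFor U p := by
  rw [tateConjectureFor_iff_invariants_le E hU p]
  intro x hx
  refine E.mem_algebraicClasses_of_pullback_mem hV hU f hζ hne ?_
  rw [show E.algebraicClasses V p = (E.ρTwist V (2 * p) p).invariants from hT]
  exact E.pullback_mem_invariants hV hU f hx

/-- **`Tᵖ(V) ⇒ Tᵖ(U)` along a morphism of non-zero degree** (`V`, `U` of the same dimension,
`f* ≠ 0` on `H²ᴺ(U)`; the case `ζ = 1` — e.g. isogenies, finite quotient maps).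
[cite: Tate1994, §1 (Conjecture Tᵖ)] [cite: Kleiman1968AlgebraicCycles, §1.2 Prop. 1.2.4] -/
theorem tateConjectureFor_of_pullback_top_ne_zero (hV : IsSmoothProjective N V)
    (hU : IsSmoothProjective N U) (f : V ⟶ U) (hf : E.pullback f (2 * N) ≠ 0) {p : ℕ}
    (hT : E.TateConjectureFor V p) : E.TateConjectureFor U p := by
  have h0 : 0 + 2 * N = 2 * N := Nat.zero_add _
  have hne : E.pushforward (N := N) hU f h0 h0 (E.one V) ≠ 0 :=
    fun h ↦ hf ((E.pushforward_one_eq_zero_iff hV hU f h0).mp h)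
  exact E.tateConjectureFor_of_pushforward_ne_zero hV hU f (r := 0) (E.one_mem_ratAlgebraicClasses hV)
    (he := by omega) (hd := h0) hne hT

/-- **`Tᵖ(X × Z) ⇒ Tᵖ(X)`** for all smooth projective `X`, `Z` (`X` is dominated by `X × Z`,
`exists_pushforward_fst_ne_zero`). [cite: Tate1994, §1 (Conjecture Tᵖ)] -/
theorem tateConjectureFor_of_tensor_left (hX : IsSmoothProjective n X) (hZ : IsSmoothProjective m Z)
    {p : ℕ} (hT : E.TateConjectureFor (X ⊗ Z) p) : E.TateConjectureFor X p := by
  obtain ⟨ζ, hζ, hne⟩ := E.exists_pushforward_fst_ne_zero hX hZ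
    (by omega : 2 * m + 2 * n = 2 * (n + m)) (Nat.zero_add _)
  exact E.tateConjectureFor_of_pushforward_ne_zero (IsSmoothProjective.tensor_holds hX hZ) hX
    (fst X Z) hζ hne hT

/-- **`Tᵖ(X × Z) ⇒ Tᵖ(Z)`** (`Z` is dominated by `X × Z`, `exists_pushforward_snd_ne_zero`).
[cite: Tate1994, §1 (Conjecture Tᵖ)] -/
theorem tateConjectureFor_of_tensor_right (hX : IsSmoothProjective n X) (hZ : IsSmoothProjective m Z)
    {p : ℕ} (hT : E.TateConjectureFor (X ⊗ Z) p) : E.TateConjectureFor Z p := by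
  obtain ⟨ζ, hζ, hne⟩ := E.exists_pushforward_snd_ne_zero hX hZ
    (by omega : 2 * n + 2 * m = 2 * (n + m)) (Nat.zero_add _)
  exact E.tateConjectureFor_of_pushforward_ne_zero (IsSmoothProjective.tensor_holds hX hZ) hZ
    (snd X Z) hζ hne hT

end GaloisWeilCohomology

end Literature.AlgebraicGeometry.Motives

end
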